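import Summits.Ventures.LatticeQCDFlow.Exactness.FlowSamplerGroupSymmetrisationMonotone
import Summits.Ventures.LatticeQCDFlow.Exactness.FlowSamplerGroupSymmetrisationKL
import HarnessLib

/-!
# More symmetrisation never hurts the training loss either: `KL(q̄_G‖w) ≤ KL(q̄_S‖w)`, `KL(w‖q̄_G) ≤ KL(w‖q̄_S)`, `∫ min(w, q̄_G) ≥ ∫ min(w, q̄_S)` for every partial average `q̄_S` of a flow over a sub-family of the symmetry group

HONEST FRAMING: exact (Metropolis-corrected) sampling algorithms for lattice gauge theory;
figures of merit are autocorrelation/cost numbers at stated couplings and volumes; no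
continuum-physics claim.  (SCALAR calibration rung S0-A: not a gauge result.)

Venture `LatticeQCDFlow` (cell pub-lqcd), topic `Exactness`; FANOUT row 2 (`s0-phi4`, FLOW arm).  NEW
WORK of the cell, joining `FlowSamplerGroupSymmetrisationMonotone` (the full group average ABSORBS
every partial average: `avg_G(q̄_S) = q̄_G`, `groupAvg_partialAvg_eq`) with gen-22's
`FlowSamplerGroupSymmetrisationKL` (averaging over measure-preserving symmetries of `w` never
increases either Kullback–Leibler divergence and never decreases the overlap).  For `G` finite acting
by measure-preserving `t_a` with the group law and `w ∘ t_a = w`, `w, q̃ > 0` measurable integrable,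
and ANY nonempty finite family `s : ι → G` (`q̄_S = |ι|⁻¹ Σ_i q̃ ∘ t_{s i}`, `q̄_G = |G|⁻¹ Σ_a q̃ ∘ t_a`):

* **`groupAvg_reverseKL_le_partialAvg`** — `q̄_S log(q̄_S/w) ∈ L¹ ⇒ q̄_G log(q̄_G/w) ∈ L¹` and
  `∫ q̄_G log(q̄_G/w) ≤ ∫ q̄_S log(q̄_S/w)` (the reverse KL = the flow's training loss up to `log Z`);
* **`groupAvg_forwardKL_le_partialAvg`** — `∫ w log(w/q̄_G) ≤ ∫ w log(w/q̄_S)`;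
* **`groupAvg_overlap_ge_partialAvg`** — `∫ min(w, q̄_S) ≤ ∫ min(w, q̄_G)`.

With `FlowSamplerGroupSymmetrisationMonotone` (`τ_int` on every sector) this says: among all partial
symmetrisations of a trained flow, the full group average is simultaneously the best in training loss,
in forward KL, in overlap, and in sector `τ_int`.  Nothing is cited as a fact.

NOT CLAIMED: strict improvement; comparisons of two partial averages; anything off the symmetry
sectors for `τ_int` (`FlowSamplerSymmetrisationMixedParity`); cost (`|G|` versus `|S|` density
evaluations per proposal); any value for any network.
-/

namespace Summit.Ventures.LatticeQCDFlow.Exactness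

open Real MeasureTheory Filter Finset Set Topology
open Summit.Ventures.LatticeQCDFlow.Scoring

variable {X : Type*} [MeasurableSpace X] {μ : Measure X} {w q : X → ℝ}
  {G : Type*} [Fintype G] [Group G] {t : G → X ≃ᵐ X}
  {ι : Type*} [Fintype ι] [Nonempty ι] {s : ι → G}

/-- `avg_G(q̄_S) = q̄_G` pointwise, beta-reduced (from `groupAvg_partialAvg_eq`). -/
theorem groupAvg_partialAvg_eq' (hmul : ∀ a b x, t (a * b) x = t a (t b x)) (x : X) :
    (∑ a, (∑ i, q (t (s i) (t a x))) / Fintype.card ι) / Fintype.card G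
      = (∑ a, q (t a x)) / Fintype.card G := by
  have h := groupAvg_partialAvg_eq (q := q) (s := s) (t := fun a => (t a : X → X)) hmul x
  beta_reduce at h
  exact h

omit [Fintype G] [Group G] in
/-- The partial average `q̄_S` is positive, measurable and integrable (no normalisation needed). -/
theorem partialAvg_pos_meas_int (ht : ∀ a, MeasurePreserving (t a) μ μ) (hq0 : ∀ x, 0 < q x)
    (hqm : Measurable q) (hqi : Integrable q μ) :
    (∀ x, 0 < (∑ i, q (t (s i) x)) / Fintype.card ι) ∧
    Measurable (fun x => (∑ i, q (t (s i) x)) / Fintype.card ι) ∧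
    Integrable (fun x => (∑ i, q (t (s i) x)) / Fintype.card ι) μ := by
  have hI : (0 : ℝ) < Fintype.card ι := by exact_mod_cast Fintype.card_pos
  refine ⟨fun x => div_pos (Finset.sum_pos (fun i _ => hq0 _) Finset.univ_nonempty) hI,
    (Finset.measurable_sum _ fun i _ => hqm.comp (t (s i)).measurable).div_const _,
    (integrable_finsetSum Finset.univ fun i _ => ?_).div_const _⟩
  exact integrable_comp_symmetry (t := fun i => t (s i)) (fun i => ht (s i)) i hqi

/-- **THE REVERSE KL OF THE FULL AVERAGE IS AT MOST THAT OF ANY PARTIAL AVERAGE.** -/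
theorem groupAvg_reverseKL_le_partialAvg [Nonempty G] (ht : ∀ a, MeasurePreserving (t a) μ μ)
    (hmul : ∀ a b x, t (a * b) x = t a (t b x)) (hw0 : ∀ x, 0 < w x) (hwm : Measurable w)
    (hwi : Integrable w μ) (hw : ∀ a x, w (t a x) = w x) (hq0 : ∀ x, 0 < q x) (hqm : Measurable q)
    (hqi : Integrable q μ)
    (hKL : Integrable (fun x => (∑ i, q (t (s i) x)) / Fintype.card ι
      * Real.log ((∑ i, q (t (s i) x)) / Fintype.card ι / w x)) μ) :
    Integrable (fun x => (∑ a, q (t a x)) / Fintype.card G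
      * Real.log ((∑ a, q (t a x)) / Fintype.card G / w x)) μ ∧
    ∫ x, (∑ a, q (t a x)) / Fintype.card G * Real.log ((∑ a, q (t a x)) / Fintype.card G / w x) ∂μ
      ≤ ∫ x, (∑ i, q (t (s i) x)) / Fintype.card ι
          * Real.log ((∑ i, q (t (s i) x)) / Fintype.card ι / w x) ∂μ := by
  obtain ⟨hS0, hSm, hSi⟩ := partialAvg_pos_meas_int (μ := μ) (s := s) ht hq0 hqm hqi
  have h := groupAvg_reverseKL_le (μ := μ) (t := t)
    (q := fun y => (∑ i, q (t (s i) y)) / Fintype.card ι) ht hw0 hwm hwi hw hS0 hSm hSi hKL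
  simp only [groupAvg_partialAvg_eq' (q := q) (s := s) (t := t) hmul] at h
  exact h

/-- **THE FORWARD KL OF THE FULL AVERAGE IS AT MOST THAT OF ANY PARTIAL AVERAGE.** -/
theorem groupAvg_forwardKL_le_partialAvg [Nonempty G] (ht : ∀ a, MeasurePreserving (t a) μ μ)
    (hmul : ∀ a b x, t (a * b) x = t a (t b x)) (hw0 : ∀ x, 0 < w x) (hwm : Measurable w)
    (hwi : Integrable w μ) (hw : ∀ a x, w (t a x) = w x) (hq0 : ∀ x, 0 < q x) (hqm : Measurable q)
    (hqi : Integrable q μ)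
    (hKL : Integrable (fun x => w x * Real.log (w x / ((∑ i, q (t (s i) x)) / Fintype.card ι))) μ) :
    Integrable (fun x => w x * Real.log (w x / ((∑ a, q (t a x)) / Fintype.card G))) μ ∧
    ∫ x, w x * Real.log (w x / ((∑ a, q (t a x)) / Fintype.card G)) ∂μ
      ≤ ∫ x, w x * Real.log (w x / ((∑ i, q (t (s i) x)) / Fintype.card ι)) ∂μ := by
  obtain ⟨hS0, hSm, hSi⟩ := partialAvg_pos_meas_int (μ := μ) (s := s) ht hq0 hqm hqi
  have h := groupAvg_forwardKL_le (μ := μ) (t := t)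
    (q := fun y => (∑ i, q (t (s i) y)) / Fintype.card ι) ht hw0 hwm hwi hw hS0 hSm hSi hKL
  simp only [groupAvg_partialAvg_eq' (q := q) (s := s) (t := t) hmul] at h
  exact h

/-- **THE OVERLAP OF THE FULL AVERAGE IS AT LEAST THAT OF ANY PARTIAL AVERAGE.** -/
theorem groupAvg_overlap_ge_partialAvg [Nonempty G] (ht : ∀ a, MeasurePreserving (t a) μ μ)
    (hmul : ∀ a b x, t (a * b) x = t a (t b x)) (hw0 : ∀ x, 0 < w x) (hwm : Measurable w)
    (hw : ∀ a x, w (t a x) = w x) (hq0 : ∀ x, 0 < q x) (hqm : Measurable q) (hqi : Integrable q μ) :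
    ∫ x, min (w x) ((∑ i, q (t (s i) x)) / Fintype.card ι) ∂μ
      ≤ ∫ x, min (w x) ((∑ a, q (t a x)) / Fintype.card G) ∂μ := by
  obtain ⟨hS0, hSm, hSi⟩ := partialAvg_pos_meas_int (μ := μ) (s := s) ht hq0 hqm hqi
  have h := groupAvg_overlap_ge (μ := μ) (t := t)
    (q := fun y => (∑ i, q (t (s i) y)) / Fintype.card ι) ht hw0 hwm hw hS0 hSm hSi
  simp only [groupAvg_partialAvg_eq' (q := q) (s := s) (t := t) hmul] at h
  exact h

end Summit.Ventures.LatticeQCDFlow.Exactness
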